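import Mathlib.Analysis.SpecialFunctions.Log.Basic
import Mathlib.Analysis.SpecialFunctions.Exp
import Mathlib.Analysis.Complex.ExponentialBounds
import Mathlib.Algebra.Order.Floor.Defs
import Mathlib.Algebra.BigOperators.Intervals
import HarnessLib

/-!
# Tao's entropy decrement argument: the pigeonholing over scales (Tao 2016, Lemma 3.2)

Topic `Literature/NumberTheory/LFunctions`.  Everything in this file is PROVED (no named facts).

This is the real-variable core of the *entropy decrement argument* in T. Tao, *The
logarithmically averaged Chowla and Elliott conjectures for two-point correlations*, Forum
Math. Pi 4 (2016) e8, §3, Lemma 3.2.  There one has, for every scale `H`, the Shannon entropy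
`F(H) = 𝐇(X_H) ∈ [0, C H]` of a window of length `H` of the (discretised) multiplicative
functions and the mutual information `I(H) = 𝐈(X_H : Y_H) ≥ 0` with the residue of `n` modulo
`P_H`, and the Shannon inequalities together with the approximate dilation invariance of
logarithmic averages give the **decrement inequality** (display (3.9) of the paper, before
division by `kH`):

  `F(kH) ≤ k (F(H) - I(H)) + C H`  whenever `H₋ ≤ H`, `kH ≤ H₊`

(the term `C H` absorbs `𝐇(Y_H) ≤ log P_H + o(1) ≪ H`, (3.12), and the `o_{A → ∞}(1)` errors).
**Lemma 3.2** then locates, by iterating this inequality along a rapidly growing sequence of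
scales and using `F ≥ 0`, a scale `H ∈ [H₋, H₊]`, divisible by a prescribed `a`, at which the
mutual information is small.  We prove it in the form suggested by the paper for optimising
bounds ("it appears to be slightly more efficient to prove a variant of this lemma in which the
right-hand side is of the form `ε^{10} H / log H`"): for any `c > 0`,

  `∃ H ∈ [H₋, H₊], a ∣ H, I(H) ≤ c H / log H`     (`exists_scale_le`)

provided `H₊` is large in terms of `a, H₋, C, c`; the printed bound `H / (log H log log log H)`
is the same argument with a slightly different bookkeeping.  Only the three displayed properties
of `F, I` are used, so the statement is about two real sequences.

## Proof sketch (as printed, with the divergence made effective)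
Scales `H₀ = a · max(H₋, 16)`, `H_{j+1} = k_j H_j` with `k_j = ⌈2C log H_j / c⌉ + 2`.  If
`I(H_j) > c H_j / log H_j` for all `j < J` then the entropy rates `f_j = F(H_j)/H_j` satisfy
`f_{j+1} ≤ f_j - c / (2 log H_j)`, so `∑_{j<J} 1/log H_j ≤ 2C/c`.  But with `L_j = log H_j`
one has `L_{j+1} ≤ L_j + D' log L_j` (`D' = log (2C/c + 3) + 1`), whence
`1/L_j ≥ (log log L_{j+1} - log log L_j)/D'` and `∑_{j<J} 1/L_j ≥ (log log L_J - log log L₀)/D'`,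
which exceeds `2C/c` for an explicit `J` because `L_J ≥ L₀ + J log 2` ("the sum diverges (very
slowly!)").

## References
* T. Tao, Forum Math. Pi 4 (2016), e8; arXiv:1509.05422, §3, Lemma 3.2 and displays
  (3.8)–(3.12); the remark following Lemma 3.2 for the `c H / log H` variant.

## Design choices
* `F, I : ℕ → ℝ` arbitrary; hypotheses: `0 ≤ F`, `F H ≤ C H`, and the decrement inequality for
  `H₋ ≤ H`, `a ∣ H`, `16 ≤ H`, `1 ≤ k`, `k H ≤ H₊` (the extra side conditions `a ∣ H`, `16 ≤ H`
  only weaken what a user must supply).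
* The conclusion also records `16 ≤ H` (so `log H > 0`) and `H₋ ≤ H ≤ H₊`, `a ∣ H`.
* The threshold `H₊₀` is existential but the proof constructs it (`scaleSeq … J`).
-/

open Finset Real

namespace Literature.NumberTheory.LFunctions

namespace Tao2016

namespace EntropyDecrement

/-! ### The sequence of scales -/

/-- The multiplier `k(H) = ⌈2 C log H / c⌉₊ + 2` used to pass from the scale `H` to the next
scale `k(H) · H` (Tao 2016, proof of Lemma 3.2: `H_{j+1} = H_j ⌊C₀ log H_j log log log H_j⌋`;
in the `c H / log H` variant the triple logarithm is not needed).
[cite: TaoFMP2016, proof of Lemma 3.2] -/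
noncomputable def mult (C c : ℝ) (H : ℕ) : ℕ := ⌈2 * C * Real.log H / c⌉₊ + 2

/-- The sequence of scales `H₀ = a · max(H₋, 16)`, `H_{j+1} = H_j · k(H_j)`.
[cite: TaoFMP2016, proof of Lemma 3.2] -/
noncomputable def scaleSeq (a Hm : ℕ) (C c : ℝ) : ℕ → ℕ
  | 0 => a * max Hm 16
  | j + 1 => scaleSeq a Hm C c j * mult C c (scaleSeq a Hm C c j)

variable {a Hm : ℕ} {C c : ℝ}

/-- The multiplier is at least `2`. [folklore] -/
theorem two_le_mult (C c : ℝ) (H : ℕ) : 2 ≤ mult C c H := Nat.le_add_left 2 _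

/-- The multiplier is positive. [folklore] -/
theorem mult_pos (C c : ℝ) (H : ℕ) : 0 < mult C c H :=
  lt_of_lt_of_le (by norm_num) (two_le_mult C c H)

/-- `k(H) ≥ 2 C log H / c`. [cite: TaoFMP2016, proof of Lemma 3.2] -/
theorem le_mult (C c : ℝ) (H : ℕ) : 2 * C * Real.log H / c ≤ mult C c H := by
  rw [mult]
  push_cast
  linarith [Nat.le_ceil (2 * C * Real.log H / c)]

/-- `k(H) ≤ 2 C log H / c + 3` when `2 C log H / c ≥ 0`. [cite: TaoFMP2016, proof of Lemma 3.2] -/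
theorem mult_le {H : ℕ} (hx : 0 ≤ 2 * C * Real.log H / c) :
    (mult C c H : ℝ) ≤ 2 * C * Real.log H / c + 3 := by
  rw [mult]
  push_cast
  linarith [(Nat.ceil_lt_add_one hx).le]

/-- Unfolding lemma: the initial scale is `a · max(H₋, 16)`. [folklore] -/
theorem scaleSeq_zero : scaleSeq a Hm C c 0 = a * max Hm 16 := rfl

/-- Unfolding lemma: `H_{j+1} = H_j · k(H_j)`. [folklore] -/
theorem scaleSeq_succ (j : ℕ) :
    scaleSeq a Hm C c (j + 1) = scaleSeq a Hm C c j * mult C c (scaleSeq a Hm C c j) := rfl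

/-- Every scale is a multiple of `a`. [cite: TaoFMP2016, Lemma 3.2 ("which is a multiple of a")] -/
theorem dvd_scaleSeq (j : ℕ) : a ∣ scaleSeq a Hm C c j := by
  induction j with
  | zero => exact Dvd.intro _ rfl
  | succ j ih => rw [scaleSeq_succ]; exact Dvd.dvd.mul_right ih _

/-- The scales are at least `a · max(H₋, 16)`; in particular `≥ 16` and `≥ H₋` when `a ≥ 1`.
[folklore] -/
theorem scaleSeq_zero_le (j : ℕ) : a * max Hm 16 ≤ scaleSeq a Hm C c j := by
  induction j with
  | zero => exact le_rfl
  | succ j ih =>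
    rw [scaleSeq_succ]
    exact ih.trans (Nat.le_mul_of_pos_right _ (mult_pos C c _))

/-- Every scale is at least `16` (when `a ≥ 1`). [folklore] -/
theorem sixteen_le_scaleSeq (ha : 1 ≤ a) (j : ℕ) : 16 ≤ scaleSeq a Hm C c j :=
  le_trans (by nlinarith [le_max_right Hm 16]) (scaleSeq_zero_le j)

/-- Every scale is at least `H₋` (when `a ≥ 1`). [folklore] -/
theorem le_scaleSeq (ha : 1 ≤ a) (j : ℕ) : Hm ≤ scaleSeq a Hm C c j :=
  le_trans (by nlinarith [le_max_left Hm 16]) (scaleSeq_zero_le j)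

/-- Every scale is positive (when `a ≥ 1`). [folklore] -/
theorem scaleSeq_pos (ha : 1 ≤ a) (j : ℕ) : 0 < scaleSeq a Hm C c j :=
  lt_of_lt_of_le (by norm_num) (sixteen_le_scaleSeq ha j)

/-- The scales increase: `H_j ≤ H_{j+1}`, indeed `2 H_j ≤ H_{j+1}`. [folklore] -/
theorem two_mul_scaleSeq_le_succ (j : ℕ) :
    2 * scaleSeq a Hm C c j ≤ scaleSeq a Hm C c (j + 1) := by
  rw [scaleSeq_succ, mul_comm]
  exact Nat.mul_le_mul_left _ (two_le_mult C c _)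

/-- The sequence of scales is monotone. [folklore] -/
theorem scaleSeq_mono : Monotone (scaleSeq a Hm C c) :=
  monotone_nat_of_le_succ fun j => le_trans (Nat.le_mul_of_pos_left _ (by norm_num))
    (two_mul_scaleSeq_le_succ j)

/-! ### Logarithms of the scales -/

/-- `L_j = log H_j ≥ log 16 > e`… we only use `L_j ≥ log 16` and `log 16 > 2.7 > 1`, and in
fact `log L_j ≥ 1` (as `16 ≥ e^e`). [folklore] -/
theorem log_sixteen_gt : (2.72 : ℝ) < Real.log 16 := by
  have h : Real.log 16 = 4 * Real.log 2 := by
    rw [show (16 : ℝ) = 2 ^ 4 by norm_num, Real.log_pow]; norm_num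
  rw [h]
  linarith [Real.log_two_gt_d9]

/-- Numerical bound `e < 2.72`. [folklore] -/
theorem exp_one_lt_272 : Real.exp 1 < 2.72 := by
  have := Real.exp_one_lt_d9
  linarith

/-- For `x ≥ 16`: `1 ≤ log (log x)` (since `16 > e^e`). [folklore] -/
theorem one_le_log_log {x : ℝ} (hx : 16 ≤ x) : 1 ≤ Real.log (Real.log x) := by
  have h1 : Real.exp 1 ≤ Real.log x := by
    calc Real.exp 1 ≤ 2.72 := exp_one_lt_272.le
      _ ≤ Real.log 16 := log_sixteen_gt.le
      _ ≤ Real.log x := Real.log_le_log (by norm_num) hx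
  calc (1 : ℝ) = Real.log (Real.exp 1) := (Real.log_exp 1).symm
    _ ≤ Real.log (Real.log x) := Real.log_le_log (Real.exp_pos 1) h1

/-- For `x ≥ 16`, `1 ≤ log x`. [folklore] -/
theorem one_le_log {x : ℝ} (hx : 16 ≤ x) : 1 ≤ Real.log x := by
  calc (1 : ℝ) ≤ 2.72 := by norm_num
    _ ≤ Real.log 16 := log_sixteen_gt.le
    _ ≤ Real.log x := Real.log_le_log (by norm_num) hx

section Logs

variable (ha : 1 ≤ a) (hC : 0 < C) (hc : 0 < c)
include ha hC hc

omit hC hc in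
/-- Notation-free access: `H_j` as a real number is `≥ 16`. [folklore] -/
theorem sixteen_le_scaleSeq_real (j : ℕ) : (16 : ℝ) ≤ scaleSeq a Hm C c j := by
  exact_mod_cast sixteen_le_scaleSeq ha j

omit hC hc in
/-- `log H_{j+1} = log H_j + log k_j ≥ log H_j + log 2`. [folklore] -/
theorem log_scaleSeq_succ (j : ℕ) :
    Real.log (scaleSeq a Hm C c (j + 1)) =
      Real.log (scaleSeq a Hm C c j) + Real.log (mult C c (scaleSeq a Hm C c j)) := by
  rw [scaleSeq_succ, Nat.cast_mul, Real.log_mul]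
  · exact_mod_cast (scaleSeq_pos ha j).ne'
  · exact_mod_cast (mult_pos C c _).ne'

omit hC hc in
/-- `log H_{j+1} ≥ log H_j + log 2`. [folklore] -/
theorem log_scaleSeq_succ_ge (j : ℕ) :
    Real.log (scaleSeq a Hm C c j) + Real.log 2 ≤ Real.log (scaleSeq a Hm C c (j + 1)) := by
  rw [log_scaleSeq_succ ha]
  gcongr
  exact_mod_cast two_le_mult C c _

omit hC hc in
/-- `log H_j ≥ log H₀ + j log 2`. [folklore] -/
theorem log_scaleSeq_ge (j : ℕ) :
    Real.log (scaleSeq a Hm C c 0) + j * Real.log 2 ≤ Real.log (scaleSeq a Hm C c j) := by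
  induction j with
  | zero => simp
  | succ j ih =>
    calc Real.log (scaleSeq a Hm C c 0) + ((j + 1 : ℕ) : ℝ) * Real.log 2
        = (Real.log (scaleSeq a Hm C c 0) + j * Real.log 2) + Real.log 2 := by
          push_cast; ring
      _ ≤ Real.log (scaleSeq a Hm C c j) + Real.log 2 := by linarith
      _ ≤ _ := log_scaleSeq_succ_ge ha j

/-- The growth of the logarithms: `log H_{j+1} ≤ log H_j + D' log log H_j` with
`D' = log (2C/c + 3) + 1`. [cite: TaoFMP2016, proof of Lemma 3.2 ("an easy induction")] -/
theorem log_scaleSeq_succ_le (j : ℕ) :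
    Real.log (scaleSeq a Hm C c (j + 1)) ≤ Real.log (scaleSeq a Hm C c j) +
      (Real.log (2 * C / c + 3) + 1) * Real.log (Real.log (scaleSeq a Hm C c j)) := by
  rw [log_scaleSeq_succ ha]
  gcongr
  set L := Real.log (scaleSeq a Hm C c j) with hL
  have hL1 : 1 ≤ L := one_le_log (sixteen_le_scaleSeq_real ha j)
  have hLL1 : 1 ≤ Real.log L := one_le_log_log (sixteen_le_scaleSeq_real ha j)
  have hx : 0 ≤ 2 * C * L / c := by positivity
  have hD : (0 : ℝ) < 2 * C / c + 3 := by positivity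
  -- `k_j ≤ 2 C L / c + 3 ≤ (2C/c + 3) L`
  have hk : (mult C c (scaleSeq a Hm C c j) : ℝ) ≤ (2 * C / c + 3) * L := by
    have := mult_le (C := C) (c := c) hx
    calc (mult C c (scaleSeq a Hm C c j) : ℝ) ≤ 2 * C * L / c + 3 := this
      _ ≤ (2 * C / c + 3) * L := by
          rw [add_mul]
          have : 2 * C * L / c = 2 * C / c * L := by ring
          rw [this]
          nlinarith
  have hkpos : (0 : ℝ) < mult C c (scaleSeq a Hm C c j) := by exact_mod_cast mult_pos C c _
  calc Real.log (mult C c (scaleSeq a Hm C c j)) ≤ Real.log ((2 * C / c + 3) * L) :=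
        Real.log_le_log hkpos hk
    _ = Real.log (2 * C / c + 3) + Real.log L := Real.log_mul hD.ne' (by linarith)
    _ ≤ (Real.log (2 * C / c + 3) + 1) * Real.log L := by
        have h2Cc : 0 < 2 * C / c := by positivity
        have hlogD : 0 ≤ Real.log (2 * C / c + 3) := Real.log_nonneg (by linarith)
        have := mul_le_mul_of_nonneg_left hLL1 hlogD
        nlinarith

/-- **The telescoping lower bound**: `1 / log H_j ≥ (log log log H_{j+1} - log log log H_j) / D'`.
[cite: TaoFMP2016, proof of Lemma 3.2] -/
theorem inv_log_scaleSeq_ge (j : ℕ) :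
    (Real.log (Real.log (Real.log (scaleSeq a Hm C c (j + 1)))) -
        Real.log (Real.log (Real.log (scaleSeq a Hm C c j)))) / (Real.log (2 * C / c + 3) + 1) ≤
      1 / Real.log (scaleSeq a Hm C c j) := by
  set L := Real.log (scaleSeq a Hm C c j) with hL
  set L' := Real.log (scaleSeq a Hm C c (j + 1)) with hL'
  set D' := Real.log (2 * C / c + 3) + 1 with hD'
  have hL1 : 1 ≤ L := one_le_log (sixteen_le_scaleSeq_real ha j)
  have hLL1 : 1 ≤ Real.log L := one_le_log_log (sixteen_le_scaleSeq_real ha j)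
  have hLL' : L ≤ L' := by
    have := log_scaleSeq_succ_ge (Hm := Hm) (C := C) (c := c) ha j
    rw [← hL, ← hL'] at this
    linarith [Real.log_two_gt_d9]
  have hL'1 : 1 ≤ L' := hL1.trans hLL'
  have hD'1 : 1 ≤ D' := by
    rw [hD']
    have : 0 ≤ Real.log (2 * C / c + 3) := Real.log_nonneg (by
      have : 0 < 2 * C / c := by positivity
      linarith)
    linarith
  have hstep : L' ≤ L + D' * Real.log L := log_scaleSeq_succ_le ha hC hc j
  -- `log L' - log L ≤ (L' - L)/L ≤ D' log L / L`
  have h1 : Real.log L' - Real.log L ≤ D' * Real.log L / L := by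
    have hq : Real.log (L' / L) ≤ L' / L - 1 := Real.log_le_sub_one_of_pos (by positivity)
    rw [Real.log_div (by linarith) (by linarith)] at hq
    calc Real.log L' - Real.log L ≤ L' / L - 1 := hq
      _ = (L' - L) / L := by field_simp
      _ ≤ D' * Real.log L / L := div_le_div_of_nonneg_right (by linarith) (by linarith)
  -- `log log L' - log log L ≤ (log L' - log L)/log L ≤ D' / L`
  have hlogL'pos : 0 < Real.log L' := by
    have := Real.log_le_log (by linarith) hLL'
    linarith
  have h2 : Real.log (Real.log L') - Real.log (Real.log L) ≤ D' / L := by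
    have hq : Real.log (Real.log L' / Real.log L) ≤ Real.log L' / Real.log L - 1 :=
      Real.log_le_sub_one_of_pos (by positivity)
    rw [Real.log_div hlogL'pos.ne' (by linarith)] at hq
    calc Real.log (Real.log L') - Real.log (Real.log L) ≤ Real.log L' / Real.log L - 1 := hq
      _ = (Real.log L' - Real.log L) / Real.log L := by field_simp
      _ ≤ (D' * Real.log L / L) / Real.log L := by gcongr
      _ = D' / L := by field_simp
  rw [div_le_iff₀ (by linarith), one_div]
  calc Real.log (Real.log L') - Real.log (Real.log L) ≤ D' / L := h2
    _ = L⁻¹ * D' := by rw [div_eq_inv_mul]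

/-- **Divergence of `∑ 1 / log H_j`**, quantitatively:
`∑_{j<J} 1/log H_j ≥ (log log log H_J - log log log H₀) / D'`.
[cite: TaoFMP2016, proof of Lemma 3.2 ("the sum diverges (very slowly!)")] -/
theorem sum_inv_log_scaleSeq_ge (J : ℕ) :
    (Real.log (Real.log (Real.log (scaleSeq a Hm C c J))) -
        Real.log (Real.log (Real.log (scaleSeq a Hm C c 0)))) / (Real.log (2 * C / c + 3) + 1) ≤
      ∑ j ∈ range J, 1 / Real.log (scaleSeq a Hm C c j) := by
  induction J with
  | zero => simp
  | succ J ih =>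
    rw [sum_range_succ]
    have := inv_log_scaleSeq_ge ha hC hc (Hm := Hm) J
    have e : ∀ x y z D : ℝ, (x - z) / D = (y - z) / D + (x - y) / D := by intros; ring
    rw [e _ (Real.log (Real.log (Real.log (scaleSeq a Hm C c J))))]
    linarith

/-- An index `J` with `∑_{j<J} 1/log H_j > T`. [cite: TaoFMP2016, proof of Lemma 3.2] -/
theorem exists_sum_inv_log_gt (T : ℝ) :
    ∃ J : ℕ, T < ∑ j ∈ range J, 1 / Real.log (scaleSeq a Hm C c j) := by
  have hD'1 : 1 ≤ Real.log (2 * C / c + 3) + 1 := by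
    have : 0 ≤ Real.log (2 * C / c + 3) := Real.log_nonneg (by
      have : 0 < 2 * C / c := by positivity
      linarith)
    linarith
  have hL₀ : 1 ≤ Real.log (scaleSeq a Hm C c 0 : ℝ) := one_le_log (sixteen_le_scaleSeq_real ha 0)
  obtain ⟨J, hJ⟩ := exists_nat_gt (Real.exp (Real.exp ((Real.log (2 * C / c + 3) + 1) * T +
    Real.log (Real.log (Real.log (scaleSeq a Hm C c 0 : ℝ))) + 1)) / Real.log 2)
  refine ⟨J, lt_of_lt_of_le ?_ (sum_inv_log_scaleSeq_ge ha hC hc J)⟩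
  set D' := Real.log (2 * C / c + 3) + 1 with hD'
  set M₀ := Real.log (Real.log (Real.log (scaleSeq a Hm C c 0 : ℝ))) with hM₀
  set LJ := Real.log (scaleSeq a Hm C c J : ℝ) with hLJ
  have hLJge : Real.log (scaleSeq a Hm C c 0 : ℝ) + J * Real.log 2 ≤ LJ :=
    log_scaleSeq_ge (C := C) (c := c) ha J
  have hlog2 := Real.log_two_gt_d9
  rw [lt_div_iff₀ (by linarith)]
  have hbig : Real.exp (Real.exp (D' * T + M₀ + 1)) < LJ := by
    rw [div_lt_iff₀ (by linarith)] at hJ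
    linarith
  -- take `log ∘ log` of `hbig`
  have h1 : Real.exp (D' * T + M₀ + 1) < Real.log LJ := by
    have := Real.log_lt_log (Real.exp_pos _) hbig
    rwa [Real.log_exp] at this
  have h2 : D' * T + M₀ + 1 < Real.log (Real.log LJ) := by
    have := Real.log_lt_log (Real.exp_pos _) h1
    rwa [Real.log_exp] at this
  linarith

end Logs

/-! ### The decrement iteration -/

/-- **Tao's entropy decrement argument (Tao 2016, Lemma 3.2; `c H / log H` variant).**
Let `a ≥ 1`, `C > 0`, `c > 0`, `H₋` be given.  There is `H₊₀` such that for every `H₊ ≥ H₊₀`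
and all real sequences `F, I` with `0 ≤ F(H) ≤ C H` and the decrement inequality
`F(kH) ≤ k (F(H) - I(H)) + C H` for `H₋ ≤ H`, `a ∣ H`, `16 ≤ H`, `1 ≤ k`, `k H ≤ H₊`, there is a
scale `H` with `H₋ ≤ H ≤ H₊`, `a ∣ H`, `16 ≤ H` and `I(H) ≤ c H / log H`.
In the paper `F(H) = 𝐇(X_H)` ((3.8): `≪_ε H`), `I(H) = 𝐈(X_H : Y_H)`, and the decrement
inequality is (3.9) (with `𝐇(Y_H) ≪ H`, (3.12)); the conclusion is (3.13) in the sharper form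
`ε^{10} H / log H` mentioned after Lemma 3.2.
[cite: TaoFMP2016, Lemma 3.2 and the remark following it] -/
theorem exists_scale_le (a : ℕ) (ha : 1 ≤ a) (Hm : ℕ) {C c : ℝ} (hC : 0 < C) (hc : 0 < c) :
    ∃ Hp₀ : ℕ, ∀ Hp : ℕ, Hp₀ ≤ Hp → ∀ F I : ℕ → ℝ,
      (∀ H, 0 ≤ F H) → (∀ H, F H ≤ C * H) →
      (∀ H k : ℕ, Hm ≤ H → a ∣ H → 16 ≤ H → 1 ≤ k → k * H ≤ Hp →
          F (k * H) ≤ k * (F H - I H) + C * H) →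
      ∃ H : ℕ, Hm ≤ H ∧ H ≤ Hp ∧ a ∣ H ∧ 16 ≤ H ∧ I H ≤ c * H / Real.log H := by
  obtain ⟨J, hJ⟩ := exists_sum_inv_log_gt (Hm := Hm) ha hC hc (2 * C / c)
  refine ⟨scaleSeq a Hm C c J, fun Hp hHp F I hF0 hFC hdec => ?_⟩
  by_contra hcon
  push Not at hcon
  -- every scale `H_j`, `j ≤ J`, is admissible, hence has large mutual information
  have hadm : ∀ j, j ≤ J → c * scaleSeq a Hm C c j / Real.log (scaleSeq a Hm C c j) <
      I (scaleSeq a Hm C c j) := fun j hj =>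
    hcon _ (le_scaleSeq ha j) ((scaleSeq_mono hj).trans hHp) (dvd_scaleSeq j)
      (sixteen_le_scaleSeq ha j)
  -- entropy rates
  set f : ℕ → ℝ := fun j => F (scaleSeq a Hm C c j) / scaleSeq a Hm C c j with hf
  -- one step of the decrement
  have hstep : ∀ j, j < J → f (j + 1) ≤ f j - c / (2 * Real.log (scaleSeq a Hm C c j)) := by
    intro j hj
    set H := scaleSeq a Hm C c j with hH
    set k := mult C c H with hk
    have hHpos : (0 : ℝ) < H := by exact_mod_cast scaleSeq_pos ha j
    have hH16 : (16 : ℝ) ≤ H := by exact_mod_cast sixteen_le_scaleSeq ha j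
    have hkpos : (0 : ℝ) < k := by exact_mod_cast mult_pos C c H
    have hlog : 1 ≤ Real.log H := one_le_log hH16
    have hkH : k * H ≤ Hp := by
      rw [mul_comm]
      exact (scaleSeq_mono (Nat.succ_le_of_lt hj)).trans hHp
    have h1 := hdec H k (le_scaleSeq ha j) (dvd_scaleSeq j) (sixteen_le_scaleSeq ha j)
      (mult_pos C c H) hkH
    have h2 : f (j + 1) = F (k * H) / (k * H) := by
      rw [hf]
      simp only
      rw [scaleSeq_succ, ← hH, ← hk, mul_comm H k, Nat.cast_mul]
    have h3 : f j = F H / H := rfl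
    rw [h2, h3]
    -- `I H / H > c / log H` and `C / k ≤ c / (2 log H)`
    have hI : c / Real.log H < I H / H := by
      have := hadm j hj.le
      rw [← hH] at this
      rw [lt_div_iff₀ hHpos]
      calc c / Real.log H * H = c * H / Real.log H := by ring
        _ < I H := this
    have hCk : C / k ≤ c / (2 * Real.log H) := by
      have hkge : 2 * C * Real.log H / c ≤ k := le_mult C c H
      rw [div_le_div_iff₀ hkpos (by positivity)]
      rw [div_le_iff₀ hc] at hkge
      nlinarith
    calc F (k * H) / (k * H) ≤ (k * (F H - I H) + C * H) / (k * H) :=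
          div_le_div_of_nonneg_right h1 (by positivity)
      _ = F H / H - I H / H + C / k := by field_simp
      _ ≤ F H / H - c / Real.log H + c / (2 * Real.log H) := by linarith
      _ = F H / H - c / (2 * Real.log H) := by ring
  -- iterate
  have hiter : ∀ n, n ≤ J → f n ≤ f 0 - ∑ j ∈ range n, c / (2 * Real.log (scaleSeq a Hm C c j)) := by
    intro n
    induction n with
    | zero => intro; simp
    | succ n ih =>
      intro hn
      rw [sum_range_succ]
      have := hstep n (Nat.lt_of_succ_le hn)
      linarith [ih (Nat.le_of_succ_le hn)]
  have hfJ := hiter J le_rfl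
  -- `f 0 ≤ C`, `f J ≥ 0`
  have hf0 : f 0 ≤ C := by
    have hpos : (0 : ℝ) < scaleSeq a Hm C c 0 := by exact_mod_cast scaleSeq_pos ha 0
    change F (scaleSeq a Hm C c 0) / scaleSeq a Hm C c 0 ≤ C
    rw [div_le_iff₀ hpos]
    exact hFC _
  have hfJ0 : 0 ≤ f J := by
    have hpos : (0 : ℝ) < scaleSeq a Hm C c J := by exact_mod_cast scaleSeq_pos ha J
    exact div_nonneg (hF0 _) hpos.le
  have hsum : ∑ j ∈ range J, c / (2 * Real.log (scaleSeq a Hm C c j)) =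
      c / 2 * ∑ j ∈ range J, 1 / Real.log (scaleSeq a Hm C c j) := by
    rw [mul_sum]
    refine sum_congr rfl fun j _ => ?_
    ring
  rw [hsum] at hfJ
  have : c / 2 * (2 * C / c) = C := by field_simp
  nlinarith [mul_lt_mul_of_pos_left hJ (half_pos hc)]

end EntropyDecrement

end Tao2016

end Literature.NumberTheory.LFunctions
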